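import Literature.Analysis.FluidPDE.FiniteFourierModeEulerCorner

/-!
# Kishimoto–Yoneda, Prop. 4.8: every occupied frequency is a vertex, hence Beltrami

Support file for `FiniteFourierModeEuler` (N. Kishimoto, T. Yoneda, J. Math. Fluid Mech. 24
(2022) 74 = arXiv:2110.08039). We PROVE the functional version of **Proposition 4.8** ("there is
no point of `S` other than the vertices of `S^{conv}`") combined with Props. 4.4/4.7: at a time at
which all modes are occupied, if `S` is not contained in a plane through the origin and the
coefficient vector at a point `n₁ ∈ S` of maximal length is a Beltrami vector with eigenvalue
`μ`, then the coefficient vector at EVERY point of `S` is a Beltrami vector with eigenvalue `μ`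
(`forall_isBV`). As in the paper: take a non-vertex point `n₀` of maximal Minkowski functional
`N(n₀) = q`, a supporting functional `f` (`≤ 1` on `S`, `= 1` at `n₀/q`), a vertex `b₀` of the
face `{f = 1}` chosen by a generic functional `g`, and a non-vertex `a₀` of the top level `{f = q}`;
the pair `(a₀, b₀)` creates a non-zero contribution at `a₀ + b₀ ∉ S` which no other pair can cancel
(the only candidate would put a vertex strictly inside a segment of `S^{conv}`), unless
`n₀ = q b₀`, which is `KY.IsFiniteModeEulerSolution.corner_false`.

## References

* [KishimotoYoneda2022] N. Kishimoto, T. Yoneda, J. Math. Fluid Mech. 24 (2022) 74 =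
  arXiv:2110.08039, §4 Prop. 4.8 (proof), with Props. 4.4, 4.7.
-/

noncomputable section

open Matrix Finset Set

namespace Literature.Analysis.FluidPDE

namespace KY.IsFiniteModeEulerSolution

open KY

variable {I : Set ℝ} {S : Finset (Fin 3 → ℝ)} {u : (Fin 3 → ℝ) → ℝ → (Fin 3 → ℂ)}

/-- **Props. 4.4, 4.7, 4.8 combined: all coefficient vectors are Beltrami with one eigenvalue.**
[cite: KishimotoYoneda2022, §4 Prop. 4.8 with Props. 4.4, 4.7] -/
theorem forall_isBV (hS : IsFiniteModeEulerSolution I S u) {t : ℝ} (ht : t ∈ I)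
    (hgen : ∀ n ∈ S, u n t ≠ 0) {s₁ s₂ s₃ : Fin 3 → ℝ} (h₁ : s₁ ∈ S) (h₂ : s₂ ∈ S) (h₃ : s₃ ∈ S)
    (hdet : s₁ ⬝ᵥ (s₂ ⨯₃ s₃) ≠ 0) {n₁ : Fin 3 → ℝ} (hn₁ : n₁ ∈ S)
    (hR : ∀ s ∈ S, s ⬝ᵥ s ≤ n₁ ⬝ᵥ n₁) {μ : ℝ} (hBV₁ : IsBV μ n₁ (u n₁ t)) :
    ∀ s ∈ S, IsBV μ s (u s t) := by
  classical
  have hfar : ∀ s ∈ S, s ≠ n₁ → n₁ ⬝ᵥ s < n₁ ⬝ᵥ n₁ := exposed_of_dot_self_eq_max hR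
  have hexpBV : ∀ x ∈ S, (∃ φ : Fin 3 → ℝ, ∀ s ∈ S, s ≠ x → φ ⬝ᵥ s < φ ⬝ᵥ x) → IsBV μ x (u x t) :=
    fun x hx hφ => hS.isBV_of_exposed ht hgen hn₁ hfar hBV₁ hx hφ
  have hμ : μ ^ 2 = n₁ ⬝ᵥ n₁ := hBV₁.sq_eq (hS.ne_zero_of_mem hn₁)
  have hexp_of_BV : ∀ x ∈ S, IsBV μ x (u x t) → ∃ φ : Fin 3 → ℝ, ∀ s ∈ S, s ≠ x → φ ⬝ᵥ s < φ ⬝ᵥ x := by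
    intro x hx h
    refine ⟨x, exposed_of_dot_self_eq_max fun s hs => ?_⟩
    rw [← h.sq_eq (hS.ne_zero_of_mem hx), hμ]; exact hR s hs
  by_contra hnot
  simp only [not_forall] at hnot
  obtain ⟨s₀, hs₀, hs₀BV⟩ := hnot
  -- the non-vertices
  set B := S.filter fun b => ¬ ∃ φ : Fin 3 → ℝ, ∀ s ∈ S, s ≠ b → φ ⬝ᵥ s < φ ⬝ᵥ b with hB
  have hBne : B.Nonempty := ⟨s₀, Finset.mem_filter.2 ⟨hs₀, fun h => hs₀BV (hexpBV s₀ hs₀ h)⟩⟩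
  have hBbad : ∀ b ∈ B, ¬ IsBV μ b (u b t) :=
    fun b hb h => (Finset.mem_filter.1 hb).2 (hexp_of_BV b (Finset.mem_filter.1 hb).1 h)
  have hbadB : ∀ b ∈ S, ¬ IsBV μ b (u b t) → b ∈ B :=
    fun b hb h => Finset.mem_filter.2 ⟨hb, fun hφ => h (hexpBV b hb hφ)⟩
  -- the Minkowski functional and the non-vertex of maximal gauge
  set K := convexHull ℝ (S : Set (Fin 3 → ℝ)) with hKdef
  have hK : K ∈ nhds (0 : Fin 3 → ℝ) := convexHull_mem_nhds_zero hS.neg_mem h₁ h₂ h₃ hdet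
  obtain ⟨y₀, hy₀B, hy₀max⟩ := B.exists_max_image (fun b => gauge K b) hBne
  have hy₀S : y₀ ∈ S := (Finset.mem_filter.1 hy₀B).1
  have hy₀0 : y₀ ≠ 0 := hS.ne_zero_of_mem hy₀S
  set q := gauge K y₀ with hqdef
  have hq0 : 0 < q := gauge_convexHull_pos hK hy₀0
  have hq1 : q ≤ 1 := gauge_convexHull_le_one hy₀S
  have hbadgauge : ∀ b ∈ S, ¬ IsBV μ b (u b t) → gauge K b ≤ q :=
    fun b hb h => hy₀max b (hbadB b hb h)
  -- the supporting functional, normalised to `φ₀ y₀ = q`, `φ₀ ≤ 1` on `S`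
  obtain ⟨φ, hφle, hφpos⟩ := exists_supporting hK (inv_gauge_smul_notMem_interior hK hy₀0)
  set Mφ := φ ⬝ᵥ (q⁻¹ • y₀) with hMφ
  set φ₀ : Fin 3 → ℝ := Mφ⁻¹ • φ with hφ₀def
  have hφ₀y : φ₀ ⬝ᵥ y₀ = q := by
    have : φ ⬝ᵥ y₀ = q * Mφ := by
      rw [hMφ, dotProduct_smul, smul_eq_mul, ← mul_assoc, mul_inv_cancel₀ hq0.ne', one_mul]
    rw [hφ₀def, smul_dotProduct, smul_eq_mul, this]; field_simp
  have hφ₀S : ∀ s ∈ S, φ₀ ⬝ᵥ s ≤ 1 := by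
    intro s hs
    have := hφle s hs
    rw [hφ₀def, smul_dotProduct, smul_eq_mul, inv_mul_le_iff₀ hφpos]; simpa using this
  have hφ₀K : ∀ z ∈ K, φ₀ ⬝ᵥ z ≤ 1 := fun z hz => dot_le_of_mem_convexHull hφ₀S hz
  have hφ₀B : ∀ b ∈ B, φ₀ ⬝ᵥ b ≤ q := by
    intro b hb
    have hbS := (Finset.mem_filter.1 hb).1
    have hr : 0 < gauge K b := gauge_convexHull_pos hK (hS.ne_zero_of_mem hbS)
    have hmem : (gauge K b)⁻¹ • b ∈ K := inv_smul_mem_convexHull_of_gauge_le hK hr le_rfl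
    have := hφ₀K _ hmem
    rw [dotProduct_smul, smul_eq_mul, inv_mul_le_iff₀ hr] at this
    linarith [hy₀max b hb]
  -- the face `F = {φ₀ = 1}` and its `g`-top vertex `b₀`
  set F := S.filter fun s => φ₀ ⬝ᵥ s = 1 with hF
  have hFne : F.Nonempty := by
    obtain ⟨s, hs, hsmax⟩ := S.exists_max_image (fun s => φ₀ ⬝ᵥ s) ⟨y₀, hy₀S⟩
    refine ⟨s, Finset.mem_filter.2 ⟨hs, le_antisymm (hφ₀S s hs) ?_⟩⟩
    have hy' : q⁻¹ • y₀ ∈ K := inv_smul_mem_convexHull_of_gauge_le hK hq0 le_rfl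
    have h1 : φ₀ ⬝ᵥ (q⁻¹ • y₀) = 1 := by
      rw [dotProduct_smul, smul_eq_mul, hφ₀y, inv_mul_cancel₀ hq0.ne']
    have := dot_le_of_mem_convexHull (fun s' hs' => hsmax s' hs') hy'
    linarith
  obtain ⟨g, hginj⟩ := exists_dot_injOn S
  obtain ⟨b₀, hb₀F, hb₀max⟩ := exists_strict_argmax hFne
    (fun x hx y hy => hginj x (Finset.mem_filter.1 hx).1 y (Finset.mem_filter.1 hy).1)
  obtain ⟨hb₀S, hb₀φ⟩ := Finset.mem_filter.1 hb₀F
  have hb₀exp : ∃ φ' : Fin 3 → ℝ, ∀ s ∈ S, s ≠ b₀ → φ' ⬝ᵥ s < φ' ⬝ᵥ b₀ := by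
    obtain ⟨ε₁, hε₁, h⟩ := exists_strict_max_perturb (S := S) (ψ := φ₀) (g := g) (x := b₀)
      (fun s hs => by rw [hb₀φ]; exact hφ₀S s hs)
      (fun s hs hφs hne => hb₀max s (Finset.mem_filter.2 ⟨hs, by rw [hφs, hb₀φ]⟩) hne)
    exact ⟨φ₀ + ε₁ • g, h ε₁ hε₁ le_rfl⟩
  have hb₀BV : IsBV μ b₀ (u b₀ t) := hexpBV b₀ hb₀S hb₀exp
  have hb₀B : b₀ ∉ B := fun h => hBbad b₀ h hb₀BV
  have hb₀0 : b₀ ≠ 0 := hS.ne_zero_of_mem hb₀S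
  -- non-vertices at level `q`
  set A := B.filter fun b => φ₀ ⬝ᵥ b = q with hA
  have hy₀A : y₀ ∈ A := Finset.mem_filter.2 ⟨hy₀B, hφ₀y⟩
  -- a non-interacting independent pair (bad, Beltrami) is contradictory
  have hcontra : ∀ a ∈ B, ∀ b ∈ S, IsBV μ b (u b t) → a ⨯₃ b ≠ 0 →
      NonInteracting a b (u a t) (u b t) → False := by
    intro a ha b hb hbBV hk hNI
    have haS := (Finset.mem_filter.1 ha).1
    have hk' : b ⨯₃ a ≠ 0 := by rwa [← cross_anticomm, neg_ne_zero]
    exact hBbad a ha (hbBV.transport hk' (hgen a haS) (hS.div_free a haS t ht)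
      ((nonInteracting_comm b a _ _).1 hNI))
  have hindep : ∀ a ∈ A, ∀ b ∈ F, a ≠ q • b → a ⨯₃ b ≠ 0 := by
    intro a ha b hb hne hk
    have hb0 : b ≠ 0 := hS.ne_zero_of_mem (Finset.mem_filter.1 hb).1
    have hdep : ¬ LinearIndependent ℝ ![b, a] := fun hli =>
      (crossProduct_ne_zero_iff_linearIndependent.2 hli) (by rwa [← cross_anticomm, neg_eq_zero])
    rw [LinearIndependent.pair_iff' hb0] at hdep
    simp only [not_forall, not_not] at hdep
    obtain ⟨c, hc⟩ := hdep
    apply hne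
    have hφa : φ₀ ⬝ᵥ a = q := (Finset.mem_filter.1 ha).2
    have hφb : φ₀ ⬝ᵥ b = 1 := (Finset.mem_filter.1 hb).2
    rw [← hc, dotProduct_smul, smul_eq_mul, hφb, mul_one] at hφa
    rw [← hc, hφa]
  -- the competitor analysis for a pair `(a, b)` with `a ∈ A`, `b ∈ F` Beltrami, `b = g`-top of `F`
  -- MAIN CASE / CORNER CASE
  by_cases hmain : (A.erase (q • b₀)).Nonempty
  · obtain ⟨a₀, ha₀, ha₀max⟩ := exists_strict_argmax hmain (fun x hx y hy =>
      hginj x (Finset.mem_filter.1 (Finset.mem_filter.1 (Finset.mem_erase.1 hx).2).1).1 y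
        (Finset.mem_filter.1 (Finset.mem_filter.1 (Finset.mem_erase.1 hy).2).1).1)
    obtain ⟨ha₀ne, ha₀A⟩ := Finset.mem_erase.1 ha₀
    have ha₀B := (Finset.mem_filter.1 ha₀A).1
    have ha₀S := (Finset.mem_filter.1 ha₀B).1
    have ha₀φ : φ₀ ⬝ᵥ a₀ = q := (Finset.mem_filter.1 ha₀A).2
    have hk := hindep a₀ ha₀A b₀ hb₀F ha₀ne
    have hab : a₀ ≠ b₀ := fun h => hb₀B (h ▸ ha₀B)
    have hsum : a₀ + b₀ ∉ S := by
      intro hmem; have := hφ₀S _ hmem; rw [dotProduct_add, ha₀φ, hb₀φ] at this; linarith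
    refine hcontra a₀ ha₀B b₀ hb₀S hb₀BV hk (hS.nonInteracting_of_others_vanish ha₀S hb₀S hab hsum ht ?_)
    intro c hc e he hce hsum' h1 h2
    have key : ∀ c ∈ S, ∀ e ∈ S, c + e = a₀ + b₀ → ¬ (c = a₀ ∧ e = b₀) → c ∈ B → False := by
      intro c hc e he hs hnot hcB
      have hs' : φ₀ ⬝ᵥ c + φ₀ ⬝ᵥ e = q + 1 := by
        rw [← dotProduct_add, hs, dotProduct_add, ha₀φ, hb₀φ]
      have hφc : φ₀ ⬝ᵥ c = q := by linarith [hφ₀B c hcB, hφ₀S e he]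
      have hφe : φ₀ ⬝ᵥ e = 1 := by linarith
      have hcA : c ∈ A := Finset.mem_filter.2 ⟨hcB, hφc⟩
      have heF : e ∈ F := Finset.mem_filter.2 ⟨he, hφe⟩
      by_cases hee : e = b₀
      · exact hnot ⟨add_right_cancel (hs.trans (by rw [hee])), hee⟩
      have hge : g ⬝ᵥ e < g ⬝ᵥ b₀ := hb₀max e heF hee
      have hgc : g ⬝ᵥ a₀ < g ⬝ᵥ c := by
        have : g ⬝ᵥ c + g ⬝ᵥ e = g ⬝ᵥ a₀ + g ⬝ᵥ b₀ := by rw [← dotProduct_add, hs, dotProduct_add]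
        linarith
      have hcq : c = q • b₀ := by
        by_contra hne
        have hmem : c ∈ A.erase (q • b₀) := Finset.mem_erase.2 ⟨hne, hcA⟩
        by_cases hca : c = a₀
        · rw [hca] at hgc; exact lt_irrefl _ hgc
        · exact absurd (ha₀max c hmem hca) (not_lt.2 hgc.le)
      have heeq : e = a₀ + (1 - q) • b₀ := by
        have : e = a₀ + b₀ - c := by rw [← hs]; abel
        rw [this, hcq, sub_smul, one_smul]; abel
      rcases hq1.lt_or_eq with hq1' | hq1'
      · -- `e` is a vertex lying strictly inside a segment of `S^{conv}`
        have heB : e ∉ B := by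
          intro heB; have := hφ₀B e heB; linarith
        have heexp : ∃ φ' : Fin 3 → ℝ, ∀ s ∈ S, s ≠ e → φ' ⬝ᵥ s < φ' ⬝ᵥ e := by
          by_contra h; exact heB (Finset.mem_filter.2 ⟨he, h⟩)
        obtain ⟨φ', hφ'⟩ := heexp
        have haK : q⁻¹ • a₀ ∈ K :=
          inv_smul_mem_convexHull_of_gauge_le hK hq0 (hbadgauge a₀ ha₀S (hBbad a₀ ha₀B))
        have hcomb : e = (1 - q) • b₀ + q • (q⁻¹ • a₀) := by
          rw [heeq, smul_smul, mul_inv_cancel₀ hq0.ne', one_smul, add_comm]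
        have := eq_of_exposed_of_convex_comb he hφ' hb₀S haK hq0 hq1' hcomb
        apply ha₀ne
        rw [← this, smul_smul, mul_inv_cancel₀ hq0.ne', one_smul]
      · -- `q = 1`: `c = b₀` would be a non-vertex
        apply hb₀B
        rw [hq1', one_smul] at hcq
        rwa [hcq] at hcB
    by_cases hcB : c ∈ B
    · exact absurd (key c hc e he hsum' h1 hcB) id
    · by_cases heB : e ∈ B
      · exact absurd (key e he c hc (by rw [add_comm]; exact hsum') (fun h => h2 ⟨h.2, h.1⟩) heB) id
      · -- both vertices: Beltrami, no interaction
        have hcBV : IsBV μ c (u c t) := by by_contra h; exact hcB (hbadB c hc h)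
        have heBV : IsBV μ e (u e t) := by by_contra h; exact heB (hbadB e he h)
        exact hcBV.nonInteracting heBV (hS.ne_zero_of_mem hc) (hS.ne_zero_of_mem he)
  · -- CORNER CASE: `A ⊆ {q b₀}`, so `y₀ = q b₀`
    have hy₀eq : y₀ = q • b₀ := by
      by_contra hne; exact hmain ⟨y₀, Finset.mem_erase.2 ⟨hne, hy₀A⟩⟩
    by_cases hF2 : (F.erase b₀).Nonempty
    · -- another vertex `b₁` of the face: the `g`-bottom one
      obtain ⟨b₁, hb₁, hb₁min⟩ := exists_strict_argmax hF2 (w := -g) (fun x hx y hy hxy =>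
        hginj x (Finset.mem_filter.1 (Finset.mem_erase.1 hx).2).1 y
          (Finset.mem_filter.1 (Finset.mem_erase.1 hy).2).1 (by
            rw [neg_dotProduct, neg_dotProduct] at hxy; exact neg_injective hxy))
      obtain ⟨hb₁b₀, hb₁F⟩ := Finset.mem_erase.1 hb₁
      obtain ⟨hb₁S, hb₁φ⟩ := Finset.mem_filter.1 hb₁F
      have hb₁bot : ∀ s ∈ F, s ≠ b₁ → g ⬝ᵥ b₁ < g ⬝ᵥ s := by
        intro s hs hne
        by_cases hsb : s = b₀
        · rw [hsb]; exact hb₀max b₁ hb₁F hb₁b₀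
        · have := hb₁min s (Finset.mem_erase.2 ⟨hsb, hs⟩) hne
          rw [neg_dotProduct, neg_dotProduct] at this; linarith
      have hb₁exp : ∃ φ' : Fin 3 → ℝ, ∀ s ∈ S, s ≠ b₁ → φ' ⬝ᵥ s < φ' ⬝ᵥ b₁ := by
        obtain ⟨ε₁, hε₁, h⟩ := exists_strict_max_perturb (S := S) (ψ := φ₀) (g := -g) (x := b₁)
          (fun s hs => by rw [hb₁φ]; exact hφ₀S s hs)
          (fun s hs hφs hne => by
            rw [neg_dotProduct, neg_dotProduct, neg_lt_neg_iff]
            exact hb₁bot s (Finset.mem_filter.2 ⟨hs, by rw [hφs, hb₁φ]⟩) hne)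
        exact ⟨φ₀ + ε₁ • (-g), h ε₁ hε₁ le_rfl⟩
      have hb₁BV : IsBV μ b₁ (u b₁ t) := hexpBV b₁ hb₁S hb₁exp
      have hyb₁ : y₀ ≠ q • b₁ := by
        rw [hy₀eq]; intro h; exact hb₁b₀ (smul_right_injective _ hq0.ne' h).symm
      have hk := hindep y₀ hy₀A b₁ hb₁F hyb₁
      have hne : y₀ ≠ b₁ := fun h => hBbad y₀ hy₀B (h ▸ hb₁BV)
      have hsum : y₀ + b₁ ∉ S := by
        intro hmem; have := hφ₀S _ hmem; rw [dotProduct_add, hφ₀y, hb₁φ] at this; linarith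
      refine hcontra y₀ hy₀B b₁ hb₁S hb₁BV hk
        (hS.nonInteracting_of_others_vanish hy₀S hb₁S hne hsum ht ?_)
      intro c hc e he hce hsum' h1 h2
      have key : ∀ c ∈ S, ∀ e ∈ S, c + e = y₀ + b₁ → ¬ (c = y₀ ∧ e = b₁) → c ∈ B → False := by
        intro c hc e he hs hnot hcB
        have hs' : φ₀ ⬝ᵥ c + φ₀ ⬝ᵥ e = q + 1 := by
          rw [← dotProduct_add, hs, dotProduct_add, hφ₀y, hb₁φ]
        have hφc : φ₀ ⬝ᵥ c = q := by linarith [hφ₀B c hcB, hφ₀S e he]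
        have hcA : c ∈ A := Finset.mem_filter.2 ⟨hcB, hφc⟩
        have hcy : c = y₀ := by
          rw [hy₀eq]; by_contra hne'; exact hmain ⟨c, Finset.mem_erase.2 ⟨hne', hcA⟩⟩
        have hs2 := hs
        rw [hcy] at hs2
        exact hnot ⟨hcy, add_left_cancel hs2⟩
      by_cases hcB : c ∈ B
      · exact absurd (key c hc e he hsum' h1 hcB) id
      · by_cases heB : e ∈ B
        · exact absurd (key e he c hc (by rw [add_comm]; exact hsum') (fun h => h2 ⟨h.2, h.1⟩) heB) id
        · have hcBV : IsBV μ c (u c t) := by by_contra h; exact hcB (hbadB c hc h)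
          have heBV : IsBV μ e (u e t) := by by_contra h; exact heB (hbadB e he h)
          exact hcBV.nonInteracting heBV (hS.ne_zero_of_mem hc) (hS.ne_zero_of_mem he)
    · -- `F = {b₀}`: `φ₀` exposes `b₀` strictly; the corner lemma
      have hstrict : ∀ s ∈ S, s ≠ b₀ → φ₀ ⬝ᵥ s < φ₀ ⬝ᵥ b₀ := by
        intro s hs hsb
        rw [hb₀φ]
        refine lt_of_le_of_ne (hφ₀S s hs) fun h => hF2 ⟨s, Finset.mem_erase.2 ⟨hsb, ?_⟩⟩
        exact Finset.mem_filter.2 ⟨hs, h⟩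
      have hy₀S' : q • b₀ ∈ S := hy₀eq ▸ hy₀S
      exact hS.corner_false ht hgen hK hb₀S hb₀BV hstrict hq0 hq1 hy₀S'
        (hy₀eq ▸ hBbad y₀ hy₀B) hbadgauge

end KY.IsFiniteModeEulerSolution

end Literature.Analysis.FluidPDE
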